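import Summits.HodgeConjecture.HodgeConjecture.Theorems.K2E3KeysThmTwoContractingRamified   -- ★ `keysThmTwoContracting_of_unramified_nonsplit` (Keys Thm (2), «Re s > 0» form, unramified `χ`, EVERY non-split `v`); brings ★ quartet `weyl_levelTrivial`
import Summits.HodgeConjecture.HodgeConjecture.Theorems.K2E3KeysThmTwoOfContracting          -- ★ the Weyl-flip pattern; brings ★ `cmPrincipalSeries_weylConj_reducible_of_reducible`, ★ `K2E3NonUnitaryCharacterDichotomy`, ★ UniqPar (`conjInvChar_normSqInv`, `conjInvChar_quadChar_mul_half`)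
import HarnessLib

/-!
# R90-TF · S1 «Ch. 12.2 local, non-split `v`» — [Keys1984 §7 Thm (2)] IN FOUR-POINT FORM FOR AN UNRAMIFIED `χ` AT EVERY NON-SPLIT PLACE (inert, tame or wild):
# `i_G(χ₁, χ₂)` reducible, `χ₁` non-unitary, `χ` trivial on `T ∩ K_v` ⇒ `χ₁ = ‖·‖^{±1}` or `χ₁ = η‖·‖^{±1/2}`, `η∣F* = ω_{E/F}`  [Rogawski1990 §12.2 (1)(2) p. 173]

Cell `hodgecm-mathlib`, crux H413 (`stmt-HodgeConjecture-24833`), route of record `HCCMUnconditional`; programme R90-TF (brief `director/R90-BRIEF.v2.md`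
1f40d54518340a35), section S1 = Ch. 12.2 local (base `R90-C10`), seat R90-C10-p04 (g0), socket S1#3 = A2 `R90.S1.stub_R90_122_keys_trichotomy` of
`Cruxes/H413/Lines/R90_S1_NonsplitLocalPacketsA.lean`, ROAD «⇐ + FRAME» — this is brick (F-a) of the FRAME (R90 bus 2026-09-04T16:0xZ).  Helper file, lane
`--supports stmt-HodgeConjecture-24833 --as helper`; ONE theorem, no definition, no instance, no notation, no `sorry`; ★-only imports (never a `Cruxes/…/Lines` module).
HONEST LABEL: HC_CM is proved only modulo the 7 printed citations (2 remaining named inputs: hLiu418 = stmt-HodgeConjecture-24832, h413 = stmt-HodgeConjecture-24833)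
until rung 0 closes; count-neutral (★-assembly; no printed citation discharged beyond what ★ `keysThmTwoContracting_of_unramified_nonsplit` already carries).

WHY.  The «⇒» half of socket A2 needs Keys' Theorem §7 (2) («`i_G(χ)` reducible, `χ₁` non-unitary ⇒ `χ₁ ∈ {‖·‖^{±1}} ∪ {η‖·‖^{±1/2} : η∣F* = ω}`»).  The tree holds its
«`Re s > 0`» (CONTRACTING) normal form for every `χ` trivial on `T ∩ K_v` at EVERY non-split place — ★ `K2E3KeysThmTwoContractingRamified.keysThmTwoContracting_of_unramified_nonsplit`
(inert: ★ p856959; ramified tame∕wild: the Iwahori criterion ★) — and the POINTWISE Weyl flip that turns the contracting form into the four-point form at INERT places only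
(★ `K2E3KeysReducibleListUnramifiedInert.keysThmTwo_of_unramified_inert`, written before the ramified rungs landed).  This file is that flip with the inert rung replaced by
the every-non-split-place rung: the hypothesis `hunr : Algebra.IsUnramifiedIn (𝓞 L) v` is DROPPED.

THE PROOF (verbatim the pattern of ★ `keysThmTwo_of_unramified_inert`).  ★ dichotomy `contracting_or_expanding_of_exists_norm_ne_one`: a non-unitary continuous `χ₁` is
contracting or expanding.  Contracting ⇒ the rung.  Expanding ⇒ `wχ = (χ̄₁⁻¹, χ₂)` is contracting (★ `conjInvChar_contracting_of_expanding`), non-unitary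
(★ `exists_norm_conjInvChar_ne_one`), again trivial on `T ∩ K_v` (★ `weyl_levelTrivial`), and `i_G(wχ)` is reducible (★ `cmPrincipalSeries_weylConj_reducible_of_reducible`,
[§12.2 «`i_G(χ)` and `i_G(wχ)` have the same sets of constituents»], regularity by ★ `cmTorusCharPair_ne_weyl_of_exists_norm_ne_one`); the rung at `wχ` and `w² = 1`
(★ `conjInvChar_conjInvChar`, ★ `conjInvChar_normSqInv`, ★ `conjInvChar_quadChar_mul_half`) give the `‖·‖⁻¹` ∕ `η‖·‖^{-1/2}` points.

## References
* [Keys1984] D. Keys, *Principal series representations of special unitary groups over local fields*, Compositio Math. 51 (1984) 115–130: §7 Theorem (2) p. 126.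
* [Rogawski1990] J. D. Rogawski, *Automorphic Representations of Unitary Groups in Three Variables*, Ann. of Math. Stud. 123 (1990): §12.2 (1)–(2) p. 173.
* [BernsteinZelevinsky1977] I. N. Bernstein, A. V. Zelevinsky, *Induced representations of reductive p-adic groups I*, Ann. Sci. ÉNS 10 (1977): Thm. 2.9.
* [Casselman1980] W. Casselman, *The unramified principal series of p-adic groups I*, Compositio Math. 40 (1980): §3.
-/

set_option autoImplicit false
-- the mandated namespace repeats the single-problem summit's segment (`HodgeConjecture.HodgeConjecture`)
set_option linter.dupNamespace false

noncomputable section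

open NumberField IsDedekindDomain
open scoped Matrix

open Literature.NumberTheory Literature.NumberTheory.Automorphic Literature.NumberTheory.Automorphic.UnitaryGroup
open Literature.NumberTheory.Rogawski1990
open Summit.HodgeConjecture.HodgeConjecture.Cruxes.H413

namespace Summit.HodgeConjecture.HodgeConjecture.R90.S1

variable (L : Type) [Field L] [NumberField L] [IsCMField L]

set_option synthInstance.maxHeartbeats 400000 in
set_option maxHeartbeats 3200000 in
-- statement-heavy: the `SmoothInd` carrier of `cmPrincipalSeries` (same budget class as ★ `keysThmTwo_of_unramified_inert`)
/-- **[Keys1984 §7 Thm (2)], FOUR-POINT FORM, FOR AN UNRAMIFIED `χ` AT EVERY NON-SPLIT PLACE.**  `v` non-split (`hns`, inert OR ramified, dyadic included); `χ = (χ₁, χ₂)` continuous,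
trivial on `T ∩ K_v` (`hU`, `K_v = U(Φ₃)(𝒪_v)` = ★ `cmLocalIntegralLevel L 3 (qsForm L) v`; = §0 `IsUnramifiedTorusChar` of the S1 socket file, unfolded), `χ₁` NON-UNITARY (`hnu`);
if `i_G(χ₁, χ₂)` has a `G`-stable `⊥ ≠ N ≠ ⊤` then `χ₁ = ‖·‖^{±1}` (`‖·‖ = halfModulusChar²`) or `χ₁ = η‖·‖^{±1/2}` with `η∣_{F_v^×} = ω_{E_w/F_v}` (★ `IsQuadraticCharExtension`), `η`
continuous.  Contracting `χ₁`: ★ `keysThmTwoContracting_of_unramified_nonsplit`; expanding: flip by `w` (★ `weyl_levelTrivial`, ★ `cmPrincipalSeries_weylConj_reducible_of_reducible`)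
and flip back (`w² = 1`). [cite: Keys1984, §7 Theorem (2) p. 126] [cite: Rogawski1990, §12.2 (1)–(2) p. 173] [cite: BernsteinZelevinsky1977, Thm. 2.9] -/
theorem keysThmTwo_of_unramified_nonsplit (v : HeightOneSpectrum (𝓞 ↥(maximalRealSubfield L)))
    (hns : ∀ w : PlacesOver L v, IsCMField.complexConj L • w.1 = w.1)
    (χ₁ : (LocalRing L v)ˣ →* ℂˣ) (χ₂ : ↥(normOneUnits (conjLocal L (IsCMField.complexConj L) v)) →* ℂˣ)
    (h1c : Continuous fun x => ((χ₁ x : ℂˣ) : ℂ)) (h2c : Continuous fun x => ((χ₂ x : ℂˣ) : ℂ)) (hnu : ∃ x, ‖((χ₁ x : ℂˣ) : ℂ)‖ ≠ 1)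
    (hU : ∀ t : ↥(torusU (conjLocal L (IsCMField.complexConj L) v) (cmLocalForm L 3 v)),
      (t : ↥(unitaryGroupOfForm (conjLocal L (IsCMField.complexConj L) v) (cmLocalForm L 3 v))) ∈ cmLocalIntegralLevel L 3 (qsForm L) v →
        cmTorusCharPair L v χ₁ χ₂ t = 1)
    (hred : ∃ N : Subrepresentation (cmPrincipalSeries L 3 v (cmTorusCharPair L v χ₁ χ₂)), N ≠ ⊥ ∧ N ≠ ⊤) :
    (χ₁ = halfModulusChar (LocalRing L v) * halfModulusChar (LocalRing L v) ∨
        χ₁ = (halfModulusChar (LocalRing L v) * halfModulusChar (LocalRing L v))⁻¹) ∨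
      (∃ η : (LocalRing L v)ˣ →* ℂˣ, IsQuadraticCharExtension (conjLocal L (IsCMField.complexConj L) v) η ∧
        Continuous (fun x => ((η x : ℂˣ) : ℂ)) ∧
        (χ₁ = η * halfModulusChar (LocalRing L v) ∨ χ₁ = η * (halfModulusChar (LocalRing L v))⁻¹)) := by
  rcases K2E3NonUnitaryCharacterDichotomy.contracting_or_expanding_of_exists_norm_ne_one L v hns χ₁ h1c hnu with hc | he
  · rcases K2E3KeysThmTwoContractingRamified.keysThmTwoContracting_of_unramified_nonsplit L v hns χ₁ χ₂ h1c h2c hnu hc hU hred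
      with h | ⟨η, hq, hηc, h⟩
    · exact Or.inl (Or.inl h)
    · exact Or.inr ⟨η, hq, hηc, Or.inl h⟩
  · -- the expanding case: flip by `w` (the flipped pair is again unramified, non-unitary, now contracting; `i_G(wχ)` is reducible)
    have h1c' : Continuous fun x => ((conjInvChar (conjLocal L (IsCMField.complexConj L) v) χ₁ x : ℂˣ) : ℂ) :=
      F0P2pTorusPairsAndVacuity.continuous_coe_conjInvChar _ (continuous_conjLocal L (IsCMField.complexConj L) v) χ₁ h1c
    have hnu' := K2E3NonUnitaryCharacterDichotomy.exists_norm_conjInvChar_ne_one L v χ₁ hnu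
    have hc' : ∀ x : (LocalRing L v)ˣ, unitModulusChar (LocalRing L v) x < 1 →
        ‖((conjInvChar (conjLocal L (IsCMField.complexConj L) v) χ₁ x : ℂˣ) : ℂ)‖ < 1 :=
      fun x hx => K2E3NonUnitaryCharacterDichotomy.conjInvChar_contracting_of_expanding L v χ₁ he x hx
    have hreg := K2E3NonUnitaryCharacterDichotomy.cmTorusCharPair_ne_weyl_of_exists_norm_ne_one L v hns χ₁ χ₂ h1c hnu
    have hred' := K2E3PrincipalSeriesWeylReducible.cmPrincipalSeries_weylConj_reducible_of_reducible L v hns χ₁ χ₂ h1c h2c hreg hred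
    have hU' := K2E3KeysThmTwoIwahoriQuartet.weyl_levelTrivial L v hns χ₁ χ₂ hU
    have hww : conjInvChar (conjLocal L (IsCMField.complexConj L) v) (conjInvChar (conjLocal L (IsCMField.complexConj L) v) χ₁) = χ₁ :=
      F0P2pTorusPairsAndVacuity.conjInvChar_conjInvChar _ (conjLocal_conjLocal_cm L v) χ₁
    have hsq : conjInvChar (conjLocal L (IsCMField.complexConj L) v) (halfModulusChar (LocalRing L v) * halfModulusChar (LocalRing L v)) =
        (halfModulusChar (LocalRing L v) * halfModulusChar (LocalRing L v))⁻¹ := by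
      have e := congrArg (conjInvChar (conjLocal L (IsCMField.complexConj L) v)) (F0P3cStCharTSUniqPar.conjInvChar_normSqInv L v)
      rw [F0P2pTorusPairsAndVacuity.conjInvChar_conjInvChar _ (conjLocal_conjLocal_cm L v)] at e
      exact e.symm
    rcases K2E3KeysThmTwoContractingRamified.keysThmTwoContracting_of_unramified_nonsplit L v hns
        (conjInvChar (conjLocal L (IsCMField.complexConj L) v) χ₁) χ₂ h1c' h2c hnu' hc' hU' hred' with h | ⟨η, hq, hηc, h⟩
    · refine Or.inl (Or.inr ?_)
      rw [← hww, h, hsq]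
    · refine Or.inr ⟨η, hq, hηc, Or.inr ?_⟩
      rw [← hww, h, F0P3cStCharTSUniqPar.conjInvChar_quadChar_mul_half L v η hq]

end Summit.HodgeConjecture.HodgeConjecture.R90.S1

end
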